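import Literature.MathematicalPhysics.QuantumFieldTheory.Balaban1983to89.BlockAveragingTowerStraightTransportLocal
import Literature.MathematicalPhysics.QuantumFieldTheory.Balaban1983to89.B15Eq177GaugeInvariance
import HarnessLib

/-!
# `Balaban1983to89.BlockAveragingTowerStraightTransportTowers` — THE `k`-FOLD (0.4) AVERAGE VERSUS THE FINE STRAIGHT TRANSPORTER,
# HYPOTHESIS KEYED ON THE THREE `k`-BLOCK TOWERS `B^k(c₋ − e_c)`, `B^k(c₋)`, `B^k(c₊)` ONLY

Cell `pub-ymgap` (Track A DAG, node N12 [Balaban1989LargeFieldI] = [B15]), width seat `dag-n12-w2` (g4); count-neutral Literature helper, the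
TOWER edition of the sibling `BlockAveragingTowerStraightTransportLocal` (same seat).  HONEST FRAMING: lattice bookkeeping on the tree's own
objects; nothing of Bałaban's is asserted; no node is discharged; one finite `𝕋⁴` programme at fixed `ε`; nothing here bears on the continuum ∕
OS ∕ mass-gap statement.

WHY.  The sibling's ★★ `dist1_iter_blockAvg_mul_inv_straight_le_local` asks the correction-factor letter `dist1 (corr ℰ (M^j U₀) c′) ≤ κ j` for the
coarse bonds `c′` whose `(j+1)`-fold centre lies ON the fine segment `[embIter k c₋ → L^k e_c]`, and its plaquette edition asks [Balaban1987RG1] (0.4)'s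
loop variables to be small through the plaquettes based in the three `(j+1)`-blocks around each such `c′`.  The consumers' regularity letters
([Balaban1988Convergent] (2.14) at a minimiser; [Balaban1985Averaging] Prop. 1 ∕ 2 in local form, tree `BlockAveragingPlaquetteBoundLocal`, Summits-side
`…N21LocalAveragedRegularityBoxes` ∕ `…N11LocalIteratedAveraging`) are REGION statements: «every level-`j` plaquette of `M^j U₀` based in a union of
`k`-block towers is small».  This file re-keys the hypothesis on the `k`-ANCESTOR `B^k(ι_{j+1} ·) = blockIter k (embIter (j+1) ·)` ([Balaban1987RG1]
(0.1)∕(0.3): the nested cubes): the correction factors are asked for the level-`(j+1)` bonds `c′ ∥ c` whose three blocks `c′₋ − e_c`, `c′₋`, `c′₊` have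
`k`-ancestors in `{c₋ − e_c, c₋, c₊}`, `{c₋, c₊}`, `{c₋, c₊}` respectively (§2), and the plaquettes for `q` with `B^k(ι_{j+1}(B(q₋))) ∈ {c₋ − e_c, c₋, c₊}` (§3).

WHAT IS PROVED (no `def`, no `sorry`; `G` any `GaugeGroup`, `ℰ` any `LoopAverage` in §1–§2; standing range `k ≤ m + K`):
* §1 one-level centred-block arithmetic ([Balaban1987RG1] (0.1)∕(0.3), `L` odd): `iterate_shift_apply`, ★ `blockOf_iterate_shift_emb_of_two_mul_lt`
  (`B(emb v + r e_μ) = v` for `2r < L`), ★ `blockOf_iterate_shift_emb_of_lt_two_mul` (`= v + e_μ` for `L < 2r`, `r ≤ L`), `blockOf_iterate_shift_emb`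
  (either, `r ≤ L`), `blockOf_unshift_emb` (`B(emb v − e_μ) = v`, `L ≥ 3`); `B^k(ι_k y) = y` is the tree's `B15Eq177GaugeInvariance.blockIter_embIter`;
* §2 ★★ `dist1_iter_blockAvg_mul_inv_straight_le_towers` — the sibling's title theorem with the hypothesis keyed on the ancestors (induction on `k` as
  there; the sub-bonds' ancestor clauses climb one level by §1), ★ `dist1_straight_le_towers`;
* §3 `SU(N)`, `ℰ = expMeanLogSU`: ★★ `dist1_iter_mul_inv_straight_le_of_plaqSmall_towers` and ★ `dist1_straight_le_of_plaqSmall_towers` — the letter is now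
  «for every `j < k`, every level-`j` plaquette `q` of `M^j U₀` with `B^k(ι_{j+1}(B(q₋))) ∈ {c₋ − e_c, c₋, c₊}` satisfies `|M^j U₀(∂q) − 1| < a j`»
  (`BlockAveragingPlaquetteBoundLocal.dist1_corr_le_local`).
WHAT THIS IS NOT: no statement about which plaquettes of `M^j U₀` are small (the caller's [III] (2.14) ∕ Prop. 1–2 letters); constants crude.

References: T. Bałaban, CMP 109 (1987) 249–301 [Balaban1987RG1] ((0.1), (0.3) pp.251–252, (0.4), (0.11) p.253); CMP 98 (1985) 17–51 [Balaban1985Averaging]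
((26)–(27) p.22); CMP 95 (1984) 17–40 [Balaban1984PropagatorsI] ((1.7) p.18).
-/

noncomputable section

open scoped BigOperators

namespace Literature.MathematicalPhysics.QuantumFieldTheory.Balaban1983to89.BlockAveragingTowerStraightTransportTowers

open T4Continuum BlockAveraging AveragingRT B15DeterminingSets BlockAveragingTowerStraightTransportLocal
open B14.Eq22Determines (blockIter blockIter_zero blockIter_succ)
open B15Eq177GaugeInvariance (blockIter_embIter)

/-! ## §1 One-level centred-block arithmetic -/

section OneLevel

variable {P : Params} {j : ℕ}

/-- Coordinates of an iterated unit shift: `(x + r e_μ)_ν = x_ν + [ν = μ]·r` (every level `j`; the tree's `Node00.OpsYTransport.iterate_shift_apply` is the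
level-`0` instance, not imported here). [cite: Balaban1987RG1, (0.1) p.251] -/
theorem iterate_shift_apply (x : Site P j) (μ : Fin P.d) (r : ℕ) (ν : Fin P.d) :
    ((fun z : Site P j => z.shift μ)^[r] x) ν = x ν + if ν = μ then (r : ZMod (P.sitesPerDir j)) else 0 := by
  rw [← walkEnd_replicate_true_eq_iterate, walkEnd_apply, T4ReflectionCone.netDisp_replicate]
  by_cases h : ν = μ
  · subst h; simp
  · simp [h, Ne.symm h]

/-- ★ `B(emb v + r e_μ) = v` for `2r < L`: the first half of the straight segment from a block centre stays in the block (centred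
convention of [Balaban1987RG1] (0.3), `L` odd; standing range). [cite: Balaban1987RG1, (0.3) p.252] -/
theorem blockOf_iterate_shift_emb_of_two_mul_lt (hj : j + 1 ≤ P.m + P.K) (v : Site P (j + 1)) (μ : Fin P.d) {r : ℕ}
    (hr : 2 * r < P.L) : blockOf ((fun z : Site P j => z.shift μ)^[r] (emb v)) = v := by
  have hL := AveragingRT.two_mul_half_add_one P
  refine blockOf_eq_of_near_emb hj v _ (fun ν => if ν = μ then (r : ℤ) else 0) (fun ν => ?_) (fun ν => ?_)
  · rw [iterate_shift_apply]
    by_cases h : ν = μ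
    · subst h; simp
    · simp [h]
  · by_cases h : ν = μ
    · subst h; simp only [if_true]; constructor <;> omega
    · simp only [if_neg h]; constructor <;> omega

/-- ★ `B(emb v + r e_μ) = v + e_μ` for `L < 2r`, `r ≤ L`: the second half of the segment lies in the next block (it is the first half of the
segment seen backwards from the next centre `emb (v + e_μ) = emb v + L e_μ`). [cite: Balaban1987RG1, (0.3) p.252] -/
theorem blockOf_iterate_shift_emb_of_lt_two_mul (hj : j + 1 ≤ P.m + P.K) (v : Site P (j + 1)) (μ : Fin P.d) {r : ℕ}
    (hr : P.L < 2 * r) (hrL : r ≤ P.L) : blockOf ((fun z : Site P j => z.shift μ)^[r] (emb v)) = v.shift μ := by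
  have hL := AveragingRT.two_mul_half_add_one P
  -- `emb (v + e_μ) = (emb v + r e_μ) + (L - r) e_μ`
  have hcentre : emb (v.shift μ) = (fun z : Site P j => z.shift μ)^[P.L - r] ((fun z : Site P j => z.shift μ)^[r] (emb v)) := by
    rw [← Function.iterate_add_apply, Nat.sub_add_cancel hrL, ← walkEnd_replicate_true_eq_iterate, walkEnd_replicate_L]
  refine blockOf_eq_of_near_emb hj (v.shift μ) _ (fun ν => if ν = μ then -((P.L - r : ℕ) : ℤ) else 0) (fun ν => ?_) (fun ν => ?_)
  · rw [hcentre, iterate_shift_apply _ μ (P.L - r) ν]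
    by_cases h : ν = μ
    · subst h; simp
    · simp [h]
  · by_cases h : ν = μ
    · subst h; simp only [if_true]; constructor <;> omega
    · simp only [if_neg h]; constructor <;> omega

/-- `B(emb v + r e_μ) ∈ {v, v + e_μ}` for `r ≤ L` (`L` odd, so `2r ≠ L`). [cite: Balaban1987RG1, (0.3) p.252] -/
theorem blockOf_iterate_shift_emb (hj : j + 1 ≤ P.m + P.K) (v : Site P (j + 1)) (μ : Fin P.d) {r : ℕ} (hrL : r ≤ P.L) :
    blockOf ((fun z : Site P j => z.shift μ)^[r] (emb v)) = v ∨
      blockOf ((fun z : Site P j => z.shift μ)^[r] (emb v)) = v.shift μ := by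
  rcases Nat.lt_or_ge (2 * r) P.L with h | h
  · exact Or.inl (blockOf_iterate_shift_emb_of_two_mul_lt hj v μ h)
  · have hne : 2 * r ≠ P.L := fun h' => by
      obtain ⟨t, ht⟩ := P.hL.1; omega
    exact Or.inr (blockOf_iterate_shift_emb_of_lt_two_mul hj v μ (lt_of_le_of_ne h (Ne.symm hne)) hrL)

/-- `B(emb v − e_μ) = v`: the site just before a block centre lies in the same block (`L ≥ 3`; it is `emb (v − e_μ) + (L−1) e_μ` and
`2(L−1) > L`).  (Prints like the Summits-side `…Theorems.BalabanUVNodesN12FlatLinAvgOntoPins.blockOf_unshift_emb`, not importable here.) [cite: Balaban1987RG1, (0.3) p.252] -/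
theorem blockOf_unshift_emb (hj : j + 1 ≤ P.m + P.K) (v : Site P (j + 1)) (μ : Fin P.d) :
    blockOf ((emb v).unshift μ) = v := by
  have hL3 : 3 ≤ P.L := by obtain ⟨t, ht⟩ := P.hL.1; have := P.hL.2; omega
  have h : (emb v).unshift μ = (fun z : Site P j => z.shift μ)^[P.L - 1] (emb (v.unshift μ)) := by
    have h1 : (fun z : Site P j => z.shift μ)^[P.L] (emb (v.unshift μ)) = emb v := by
      rw [← walkEnd_replicate_true_eq_iterate, walkEnd_replicate_L, Site.shift_unshift]
    have h2 : (fun z : Site P j => z.shift μ)^[P.L] (emb (v.unshift μ)) =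
        ((fun z : Site P j => z.shift μ)^[P.L - 1] (emb (v.unshift μ))).shift μ := by
      conv_lhs => rw [show P.L = P.L - 1 + 1 by omega, Function.iterate_succ_apply']
    rw [← h1, h2, Site.unshift_shift]
  rw [h, blockOf_iterate_shift_emb_of_lt_two_mul hj (v.unshift μ) μ (by omega) (Nat.sub_le _ _), Site.shift_unshift]

end OneLevel

/-! ## §2 ★★ The `k`-fold average versus the fine straight transporter, hypothesis keyed on the `k`-ancestors -/

section Main

variable {P : Params} {G : Type*} [GaugeGroup G]

/-- ★★ **`(M^k U₀)(c)` IS THE FINE STRAIGHT TRANSPORTER UP TO `θ k`, UNDER A HYPOTHESIS ON THE `k`-BLOCK TOWERS OF `c₋ − e_c`, `c₋`, `c₊` ONLY.**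
`ℰ` any `LoopAverage`, `M^j U₀ = Averaging.iter (fun i => blockAvg ℰ) j U₀`, standing range `k ≤ m + K`.  Hypothesis (the letter `hκ`): for every `j < k`
and every level-`(j+1)` bond `c′ ∥ c` whose blocks have `k`-ancestors `B^k(ι_{j+1}(c′₋ − e_c)) ∈ {c₋ − e_c, c₋, c₊}`, `B^k(ι_{j+1} c′₋) ∈ {c₋, c₊}`,
`B^k(ι_{j+1} c′₊) ∈ {c₋, c₊}`, the correction factor satisfies `dist1 (corr ℰ (M^j U₀) c′) ≤ κ j`; and `0 ≤ θ 0`, `κ j + L·θ j ≤ θ (j+1)`.  Conclusion: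
`dist1 ((M^k U₀)(c) · U₀([embIter k c₋ → L^k e_c])⁻¹) ≤ θ k`.  (Induction on `k` as in the sibling; the sub-bonds `emb c₋ + t e_c`, `t < L`, of the
level-`(k+1)` bond `c` pass their ancestor clauses up one level by §1.) [cite: Balaban1987RG1, (0.3) p.252, (0.4) and (0.11) p.253] -/
theorem dist1_iter_blockAvg_mul_inv_straight_le_towers (ℰ : LoopAverage G) (U₀ : GaugeField P 0 G) (κ θ : ℕ → ℝ)
    (hθ0 : 0 ≤ θ 0) (hθ : ∀ j, κ j + P.L * θ j ≤ θ (j + 1)) :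
    ∀ (k : ℕ), k ≤ P.m + P.K → ∀ (c : PBond P k),
      (∀ j < k, ∀ c' : PBond P (j + 1), c'.dir = c.dir →
          (blockIter k (embIter (j + 1) (c'.src.unshift c.dir)) = c.src.unshift c.dir ∨
            blockIter k (embIter (j + 1) (c'.src.unshift c.dir)) = c.src ∨
            blockIter k (embIter (j + 1) (c'.src.unshift c.dir)) = c.tgt) →
          (blockIter k (embIter (j + 1) c'.src) = c.src ∨ blockIter k (embIter (j + 1) c'.src) = c.tgt) →
          (blockIter k (embIter (j + 1) c'.tgt) = c.src ∨ blockIter k (embIter (j + 1) c'.tgt) = c.tgt) →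
          dist1 (corr ℰ (Averaging.iter (fun i => blockAvg (P := P) (j := i) ℰ) j U₀) c') ≤ κ j) →
      dist1 (Averaging.iter (fun i => blockAvg (P := P) (j := i) ℰ) k U₀ c *
          (holAt U₀ (walk (embIter k c.src) (List.replicate (P.L ^ k) (c.dir, true))))⁻¹) ≤ θ k := by
  intro k
  induction k with
  | zero =>
    intro _ c _
    have h0 : Averaging.iter (fun i => blockAvg (P := P) (j := i) ℰ) 0 U₀ = U₀ := rfl
    rw [h0, pow_zero, show embIter 0 c.src = c.src from rfl, holAt_walk_replicate_true_one, mul_inv_cancel, GaugeGroup.dist1_one]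
    exact hθ0
  | succ k ih =>
    intro hk c hκ
    have hk' : k ≤ P.m + P.K := Nat.le_of_succ_le hk
    set V := Averaging.iter (fun i => blockAvg (P := P) (j := i) ℰ) k U₀ with hV
    have hiter : Averaging.iter (fun i => blockAvg (P := P) (j := i) ℰ) (k + 1) U₀ c = corr ℰ V c * axialAvg V c := rfl
    rw [hiter, axialAvg_eq_holAt_walk, holAt_straight_embIter_succ]
    set S : GaugeField P k G := fun c' : PBond P k => holAt U₀ (walk (embIter k c'.src) (List.replicate (P.L ^ k) (c'.dir, true)))
      with hS
    -- the correction factor at `c` itself (`j = k`): the three blocks of `c` are their own `(k+1)`-ancestors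
    have hκc : dist1 (corr ℰ V c) ≤ κ k := by
      refine hκ k (Nat.lt_succ_self k) c rfl ?_ ?_ ?_
      · exact Or.inl (blockIter_embIter (k + 1) hk _)
      · exact Or.inl (blockIter_embIter (k + 1) hk _)
      · exact Or.inr (blockIter_embIter (k + 1) hk _)
    -- one-level ancestor arithmetic for the sub-bonds `emb c₋ + t e_c`, `t < L`
    have hsrc : ∀ t, t ≤ P.L → blockOf ((fun z : Site P k => z.shift c.dir)^[t] (emb c.src)) = c.src ∨
        blockOf ((fun z : Site P k => z.shift c.dir)^[t] (emb c.src)) = c.tgt :=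
      fun t ht => blockOf_iterate_shift_emb hk c.src c.dir ht
    have hleft : ∀ t, t < P.L → blockOf (((fun z : Site P k => z.shift c.dir)^[t] (emb c.src)).unshift c.dir) = c.src ∨
        blockOf (((fun z : Site P k => z.shift c.dir)^[t] (emb c.src)).unshift c.dir) = c.tgt := by
      intro t ht
      rcases Nat.eq_zero_or_pos t with rfl | htpos
      · exact Or.inl (blockOf_unshift_emb hk c.src c.dir)
      · obtain ⟨t', rfl⟩ := Nat.exists_eq_add_of_lt htpos
        simp only [zero_add, Function.iterate_succ_apply', Site.unshift_shift]
        exact hsrc t' (by omega)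
    -- climbing one level: `B^{k+1}(ι_{j+1} z) = B(B^k(ι_{j+1} z))`
    have hclimb : ∀ (j : ℕ) (z : Site P (j + 1)), blockIter (k + 1) (embIter (j + 1) z) = blockOf (blockIter k (embIter (j + 1) z)) :=
      fun j z => rfl
    -- the `L` sub-segments, each by the induction hypothesis
    have hseg : ∀ t ∈ Finset.range P.L,
        dist1 (V ⟨(fun z : Site P k => z.shift c.dir)^[t] (emb c.src), c.dir⟩ *
            (S ⟨(fun z : Site P k => z.shift c.dir)^[t] (emb c.src), c.dir⟩)⁻¹) ≤ θ k := by
      intro t ht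
      have htL : t < P.L := Finset.mem_range.mp ht
      refine ih hk' ⟨(fun z : Site P k => z.shift c.dir)^[t] (emb c.src), c.dir⟩ fun j hj c' hdir h1 h2 h3 => ?_
      have htgt : (⟨(fun z : Site P k => z.shift c.dir)^[t] (emb c.src), c.dir⟩ : PBond P k).tgt =
          (fun z : Site P k => z.shift c.dir)^[t + 1] (emb c.src) := by
        show ((fun z : Site P k => z.shift c.dir)^[t] (emb c.src)).shift c.dir = _
        rw [Function.iterate_succ_apply']
      simp only [htgt] at h1 h2 h3
      -- every ancestor named in `h1 h2 h3` is one of `(emb c₋ + t e) − e`, `emb c₋ + t e`, `emb c₋ + (t+1) e`; their blocks are `c₋` or `c₊`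
      have up : ∀ {z : Site P 0}, (blockIter k z = ((fun w : Site P k => w.shift c.dir)^[t] (emb c.src)).unshift c.dir ∨
            blockIter k z = (fun w : Site P k => w.shift c.dir)^[t] (emb c.src) ∨
            blockIter k z = (fun w : Site P k => w.shift c.dir)^[t + 1] (emb c.src)) →
          blockOf (blockIter k z) = c.src ∨ blockOf (blockIter k z) = c.tgt := by
        intro z hz
        rcases hz with hz | hz | hz
        · rw [hz]; exact hleft t htL
        · rw [hz]; exact hsrc t htL.le
        · rw [hz]; exact hsrc (t + 1) htL
      refine hκ j (Nat.lt_succ_of_lt hj) c' hdir ?_ ?_ ?_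
      · rw [hclimb]; exact Or.inr (up (by rcases h1 with h | h | h <;> simp [h]))
      · rw [hclimb]; exact up (by rcases h2 with h | h <;> simp [h])
      · rw [hclimb]; exact up (by rcases h3 with h | h <;> simp [h])
    calc dist1 (corr ℰ V c * holAt V (walk (emb c.src) (List.replicate P.L (c.dir, true))) *
            (holAt S (walk (emb c.src) (List.replicate P.L (c.dir, true))))⁻¹)
        ≤ dist1 (corr ℰ V c) + dist1 (holAt V (walk (emb c.src) (List.replicate P.L (c.dir, true))) *
            (holAt S (walk (emb c.src) (List.replicate P.L (c.dir, true))))⁻¹) := by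
          rw [mul_assoc]; exact GaugeGroup.dist1_mul_le _ _
      _ ≤ κ k + ∑ t ∈ Finset.range P.L,
            dist1 (V ⟨(fun z : Site P k => z.shift c.dir)^[t] (emb c.src), c.dir⟩ *
              (S ⟨(fun z : Site P k => z.shift c.dir)^[t] (emb c.src), c.dir⟩)⁻¹) :=
          add_le_add hκc (dist1_holAt_straight_mul_inv_le V S c.dir P.L (emb c.src))
      _ ≤ κ k + ∑ _t ∈ Finset.range P.L, θ k := add_le_add le_rfl (Finset.sum_le_sum hseg)
      _ = κ k + P.L * θ k := by rw [Finset.sum_const, Finset.card_range, nsmul_eq_mul]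
      _ ≤ θ (k + 1) := hθ k

/-- ★ **TOWER EDITION, STRAIGHT-TRANSPORTER READING**: under the hypotheses of `dist1_iter_blockAvg_mul_inv_straight_le_towers`,
`dist1 (U₀([embIter k c₋ → L^k e_c])) ≤ θ k + dist1 ((M^k U₀)(c))`. [cite: Balaban1987RG1, (0.4) and (0.11) p.253] -/
theorem dist1_straight_le_towers (ℰ : LoopAverage G) (U₀ : GaugeField P 0 G) (κ θ : ℕ → ℝ)
    (hθ0 : 0 ≤ θ 0) (hθ : ∀ j, κ j + P.L * θ j ≤ θ (j + 1)) (k : ℕ) (hk : k ≤ P.m + P.K) (c : PBond P k)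
    (hκ : ∀ j < k, ∀ c' : PBond P (j + 1), c'.dir = c.dir →
        (blockIter k (embIter (j + 1) (c'.src.unshift c.dir)) = c.src.unshift c.dir ∨
          blockIter k (embIter (j + 1) (c'.src.unshift c.dir)) = c.src ∨
          blockIter k (embIter (j + 1) (c'.src.unshift c.dir)) = c.tgt) →
        (blockIter k (embIter (j + 1) c'.src) = c.src ∨ blockIter k (embIter (j + 1) c'.src) = c.tgt) →
        (blockIter k (embIter (j + 1) c'.tgt) = c.src ∨ blockIter k (embIter (j + 1) c'.tgt) = c.tgt) →
        dist1 (corr ℰ (Averaging.iter (fun i => blockAvg (P := P) (j := i) ℰ) j U₀) c') ≤ κ j) :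
    dist1 (holAt U₀ (walk (embIter k c.src) (List.replicate (P.L ^ k) (c.dir, true))))
      ≤ θ k + dist1 (Averaging.iter (fun i => blockAvg (P := P) (j := i) ℰ) k U₀ c) :=
  (dist1_le_dist1_mul_inv_add _ _).trans
    (add_le_add (dist1_iter_blockAvg_mul_inv_straight_le_towers ℰ U₀ κ θ hθ0 hθ k hk c hκ) le_rfl)

end Main

/-! ## §3 `SU(N)`, `ℰ = expMeanLogSU`: the letter from the plaquettes of the three towers -/

section SUN

open ExpMeanLog

variable {n : Type*} [Fintype n] [DecidableEq n] [Nonempty n] {P : Params}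

/-- ★★ **PLAQUETTE EDITION KEYED ON THE THREE TOWERS** (`SU(N)`, the printed `exp[mean log]`, standing range `k ≤ m + K`): if for every `j < k`
every level-`j` plaquette `q` of `M^j U₀` whose block `B(q₋)` has `k`-ancestor `B^k(ι_{j+1}(B(q₋))) ∈ {c₋ − e_c, c₋, c₊}` is within `a j ≥ 0` of `1`,
with `(((d+2)L)²∕4)·a j < δ_N`, then `dist1 ((M^k U₀)(c) · U₀([embIter k c₋ → L^k e_c])⁻¹) ≤ θ k` for any `θ` with `0 ≤ θ 0`,
`6·(((d+2)L)²∕4)·a j + L·θ j ≤ θ (j+1)` (`BlockAveragingPlaquetteBoundLocal.dist1_corr_le_local` at the bonds of §2's hypothesis).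
[cite: Balaban1987RG1, (0.3) p.252, (0.4) and (0.11) p.253; Balaban1985Averaging, (26)–(27) p.22] -/
theorem dist1_iter_mul_inv_straight_le_of_plaqSmall_towers (U₀ : GaugeField P 0 (Matrix.specialUnitaryGroup n ℂ)) (a θ : ℕ → ℝ)
    (hθ0 : 0 ≤ θ 0)
    (hθ : ∀ j, 6 * (((((P.d + 2) * P.L : ℕ) : ℝ) ^ 2 / 4) * a j) + P.L * θ j ≤ θ (j + 1)) (k : ℕ) (hk : k ≤ P.m + P.K)
    (c : PBond P k) (ha0 : ∀ j < k, 0 ≤ a j) (haN : ∀ j < k, ((((P.d + 2) * P.L : ℕ) : ℝ) ^ 2 / 4) * a j < deltaSU n)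
    (ha : ∀ j < k, ∀ q : Plaq P j,
        (blockIter k (embIter (j + 1) (blockOf q.src)) = c.src.unshift c.dir ∨
          blockIter k (embIter (j + 1) (blockOf q.src)) = c.src ∨ blockIter k (embIter (j + 1) (blockOf q.src)) = c.tgt) →
        dist1 (GaugeField.plaqHol (Averaging.iter (fun i => blockAvg (P := P) (j := i) (expMeanLogSU (n := n))) j U₀) q) < a j) :
    dist1 (Averaging.iter (fun i => blockAvg (P := P) (j := i) (expMeanLogSU (n := n))) k U₀ c *
        (holAt U₀ (walk (embIter k c.src) (List.replicate (P.L ^ k) (c.dir, true))))⁻¹) ≤ θ k := by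
  refine dist1_iter_blockAvg_mul_inv_straight_le_towers (expMeanLogSU (n := n)) U₀
    (fun j => 6 * (((((P.d + 2) * P.L : ℕ) : ℝ) ^ 2 / 4) * a j)) θ hθ0 hθ k hk c fun j hj c' hdir h1 h2 h3 => ?_
  refine BlockAveragingPlaquetteBoundLocal.dist1_corr_le_local (ha0 j hj) (by omega) c' (fun q hq => ha j hj q ?_) (haN j hj)
  rw [hdir] at hq
  rcases hq with hq | hq | hq
  · rw [hq]; exact h1
  · rw [hq]; exact Or.inr h2
  · rw [hq]; exact Or.inr h3

/-- ★ **PLAQUETTE EDITION KEYED ON THE THREE TOWERS, STRAIGHT-TRANSPORTER READING**: under the same hypotheses,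
`dist1 (U₀([embIter k c₋ → L^k e_c])) ≤ θ k + dist1 ((M^k U₀)(c))`. [cite: Balaban1987RG1, (0.4) and (0.11) p.253] -/
theorem dist1_straight_le_of_plaqSmall_towers (U₀ : GaugeField P 0 (Matrix.specialUnitaryGroup n ℂ)) (a θ : ℕ → ℝ)
    (hθ0 : 0 ≤ θ 0)
    (hθ : ∀ j, 6 * (((((P.d + 2) * P.L : ℕ) : ℝ) ^ 2 / 4) * a j) + P.L * θ j ≤ θ (j + 1)) (k : ℕ) (hk : k ≤ P.m + P.K)
    (c : PBond P k) (ha0 : ∀ j < k, 0 ≤ a j) (haN : ∀ j < k, ((((P.d + 2) * P.L : ℕ) : ℝ) ^ 2 / 4) * a j < deltaSU n)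
    (ha : ∀ j < k, ∀ q : Plaq P j,
        (blockIter k (embIter (j + 1) (blockOf q.src)) = c.src.unshift c.dir ∨
          blockIter k (embIter (j + 1) (blockOf q.src)) = c.src ∨ blockIter k (embIter (j + 1) (blockOf q.src)) = c.tgt) →
        dist1 (GaugeField.plaqHol (Averaging.iter (fun i => blockAvg (P := P) (j := i) (expMeanLogSU (n := n))) j U₀) q) < a j) :
    dist1 (holAt U₀ (walk (embIter k c.src) (List.replicate (P.L ^ k) (c.dir, true))))
      ≤ θ k + dist1 (Averaging.iter (fun i => blockAvg (P := P) (j := i) (expMeanLogSU (n := n))) k U₀ c) :=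
  (dist1_le_dist1_mul_inv_add _ _).trans
    (add_le_add (dist1_iter_mul_inv_straight_le_of_plaqSmall_towers U₀ a θ hθ0 hθ k hk c ha0 haN ha) le_rfl)

end SUN

end Literature.MathematicalPhysics.QuantumFieldTheory.Balaban1983to89.BlockAveragingTowerStraightTransportTowers

end
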